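import Mathlib

/-!
# A parity (GF(2)) Marica–Schönheim lemma with two blocks

Helper file for crux `stmt-CriticalPhenomena-4575` (`NoHeavyLowerTail`, route `PercNearOneGluingNoHeavy`), seat `prim-l12-p6`
gen 33; memo `run/shared/lean/prim/prim-l12/FROM-prim-l12-p6-g33-C3I-RANK-PLUS.md` §4d.  Pure finite set theory; everything PROVED.

Rows are finite sets and a row `T` of the first block ("complemented rows") is read through the vector
`U ↦ [U ∩ T = ∅]`, a row `P` of the second block ("plain rows") through `U ↦ [U ⊆ P]`, `U` ranging over a fixed
family `Δ` (in the application: the complements of the goods of a monotone map into the nine-element poset `P9`,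
memo §0).  Working modulo 2 replaces the Möbius-weighted rank argument of `…OrderedDifferences` by double counting.

* `ParityMS.parity_lemma` — if `∅ ∈ Δ`, `𝒯` has a minimal member `T₀` with `T \ T₀ ∈ Δ` for the other `T ∈ 𝒯`, and
  every `S ∈ 𝒮` has `(T₀ ∪ S)ᶜ ∈ Δ`, `T₀ ∪ S ≠ univ`, then some `U ∈ Δ` sees an ODD number of rows
  (`#{T ∈ 𝒯 : U ∩ T = ∅} + #{S ∈ 𝒮 : U ⊆ S}` odd).  Proof: count over the faces `∅`, `(T₀ ∪ S)ᶜ`, `T \ T₀`; two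
  symmetric relations contribute even numbers (handshake), leaving `|𝒯| − 1 ≡ |𝒯|`.
* `ParityMS.card_add_card_le_card` — consequently, if the plain block `ℬ` is GF(2)-independent on `Δ` (every nonempty
  `B ⊆ ℬ` is seen oddly by some `U ∈ Δ`), all differences `T \ T₀` (`T ⊄ T₀`) inside `𝒞` lie in `Δ`, and all
  `(T ∪ P)ᶜ` (`T ∈ 𝒞`, `P ∈ ℬ`) lie in `Δ` with `T ∪ P ≠ univ`, then `#𝒞 + #ℬ ≤ #Δ` (the parity vectors of the
  `2^{#𝒞 + #ℬ}` pairs of subfamilies are pairwise distinct subsets of `Δ`).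
* `ParityMS.plain_oddly_seen` — a single plain block whose differences `P₀ \ P` (`P₀ ⊄ P`) lie in `Δ` is
  GF(2)-independent; with it `card_add_card_le_card_of_diffs` is a two-family Marica–Schönheim inequality mod 2
  (compare `OrderedDifferences.card_add_card_le_card_diffs_union`).
For the cyclic pairing inequality `C3I` of the memo (`𝒞` = the bads of one class, `ℬ` = the bads of the other two
classes, `Δ` = complements of goods) all hypotheses except the independence of `ℬ` are automatic (memo §1–§2), so
`card_add_card_le_card` is "C3I modulo one consecutive plain pair" (memo §4d); the two-class case is
`card_add_card_le_card_of_diffs`.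
-/

namespace Summit.CriticalPhenomena.PercolationContinuityZ3.Theorems

namespace ParityMS

open Finset

variable {α : Type*} [DecidableEq α] [Fintype α]

/-! The *parity vector* of a pair `(A, B)` of row families at a face `U` is
`(∑ T ∈ A, [Disjoint U T]) + (∑ S ∈ B, [U ⊆ S])` in `ZMod 2` (complemented rows `A`, plain rows `B`);
we keep it expanded in all statements (no auxiliary definition). -/

omit [Fintype α] in
/-- A sum over a symmetric difference is, modulo `2`, the sum of the two sums. [this work] -/
theorem sum_symmDiff_zmod2 (A A' : Finset (Finset α)) (f : Finset α → ZMod 2) :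
    ∑ x ∈ symmDiff A A', f x = (∑ x ∈ A, f x) + ∑ x ∈ A', f x := by
  have hA : ∑ x ∈ A, f x = (∑ x ∈ A \ A', f x) + ∑ x ∈ A ∩ A', f x := by
    rw [← sum_union (disjoint_sdiff_inter A A'), sdiff_union_inter]
  have hA' : ∑ x ∈ A', f x = (∑ x ∈ A' \ A, f x) + ∑ x ∈ A ∩ A', f x := by
    rw [inter_comm, ← sum_union (disjoint_sdiff_inter A' A), sdiff_union_inter]
  have hsd : symmDiff A A' = (A \ A') ∪ (A' \ A) := symmDiff_def A A'
  have hdisj : Disjoint (A \ A') (A' \ A) := disjoint_sdiff_sdiff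
  rw [hsd, sum_union hdisj, hA, hA']
  set a := ∑ x ∈ A \ A', f x
  set b := ∑ x ∈ A' \ A, f x
  set c := ∑ x ∈ A ∩ A', f x
  have hc : c + c = 0 := CharTwo.add_self_eq_zero c
  linear_combination (-1 : ZMod 2) * hc

omit [Fintype α] in
/-- Additivity of the parity vector under symmetric differences. [this work] -/
theorem par_symmDiff (A A' B B' : Finset (Finset α)) (U : Finset α) :
    (∑ T ∈ symmDiff A A', if Disjoint U T then (1 : ZMod 2) else 0) +
        (∑ S ∈ symmDiff B B', if U ⊆ S then (1 : ZMod 2) else 0) =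
      ((∑ T ∈ A, if Disjoint U T then (1 : ZMod 2) else 0) + ∑ S ∈ B, if U ⊆ S then (1 : ZMod 2) else 0) +
      ((∑ T ∈ A', if Disjoint U T then (1 : ZMod 2) else 0) + ∑ S ∈ B', if U ⊆ S then (1 : ZMod 2) else 0) := by
  rw [sum_symmDiff_zmod2, sum_symmDiff_zmod2]
  ring

/-- In `ZMod 2` two elements that are simultaneously zero or nonzero are equal. [this work] -/
theorem zmod2_eq_of_iff {x y : ZMod 2} (h : x ≠ 0 ↔ y ≠ 0) : x = y := by
  have key : ∀ x y : ZMod 2, (x ≠ 0 ↔ y ≠ 0) → x = y := by decide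
  exact key _ _ h

/-- **Parity lemma.**  Let `∅ ∈ Δ`, let `T₀ ∈ 𝒯` be minimal in `𝒯` with `T \ T₀ ∈ Δ` for every other `T ∈ 𝒯`, and
let every `S ∈ 𝒮` satisfy `(T₀ ∪ S)ᶜ ∈ Δ` and `T₀ ∪ S ≠ univ`.  Then some face `U ∈ Δ` sees an odd number of rows:
the parity vector is nonzero at `U`.  (Double counting over the faces `∅`, `(T₀ ∪ S)ᶜ` and `T \ T₀`; the ordered pairs `(S, S')` with
`T₀ ∪ S ∪ S' = univ` and the ordered pairs `(T₁, T)` of other rows with `T ∩ T₁ ⊆ T₀` are symmetric relations without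
fixed points, hence contribute even numbers.) [this work] -/
theorem parity_lemma (Δ 𝒯 𝒮 : Finset (Finset α)) (T₀ : Finset α) (h0 : ∅ ∈ Δ) (hT₀ : T₀ ∈ 𝒯)
    (hmin : ∀ T ∈ 𝒯, T ⊆ T₀ → T = T₀) (hdiff : ∀ T ∈ 𝒯, T ≠ T₀ → T \ T₀ ∈ Δ)
    (hS : ∀ S ∈ 𝒮, (T₀ ∪ S)ᶜ ∈ Δ) (hS' : ∀ S ∈ 𝒮, T₀ ∪ S ≠ univ) :
    ∃ U ∈ Δ, (∑ T ∈ 𝒯, if Disjoint U T then (1 : ZMod 2) else 0) +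
      (∑ S ∈ 𝒮, if U ⊆ S then (1 : ZMod 2) else 0) ≠ 0 := by
  by_contra hcon
  push Not at hcon
  set E' : Finset (Finset α) := 𝒯.erase T₀ with hE'
  -- `ι S T = [T ⊆ T₀ ∪ S]`, `X` = number of pairs `(S, T) ∈ 𝒮 × E'` with `T ⊆ T₀ ∪ S` (mod 2)
  let ι : Finset α → Finset α → ZMod 2 := fun S T => if T ⊆ T₀ ∪ S then 1 else 0
  set X : ZMod 2 := ∑ S ∈ 𝒮, ∑ T ∈ E', ι S T with hX
  -- (e0) the face `∅`
  have e0 : (#𝒯 : ZMod 2) + #𝒮 = 0 := by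
    have h := hcon ∅ h0
    simpa only [Finset.disjoint_empty_left, Finset.empty_subset, if_true, sum_const, nsmul_eq_mul,
      mul_one] using h
  -- symmetric relation on `𝒮`: `T₀ ∪ S ∪ S' = univ`
  have hsymm : ∀ S S' : Finset α, ((T₀ ∪ S)ᶜ ⊆ S' ↔ (T₀ ∪ S')ᶜ ⊆ S) := by
    intro S S'
    simp only [subset_iff, mem_compl, mem_union, not_or]
    constructor
    · intro h x hx
      by_contra hxS
      exact hx.2 (h ⟨hx.1, hxS⟩)
    · intro h x hx
      by_contra hxS
      exact hx.2 (h ⟨hx.1, hxS⟩)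
  -- the double sum over the symmetric relation vanishes
  have hhand : ∑ S ∈ 𝒮, ∑ S' ∈ 𝒮, (if (T₀ ∪ S)ᶜ ⊆ S' then (1 : ZMod 2) else 0) = 0 := by
    rw [← sum_product (s := 𝒮) (t := 𝒮) (f := fun p => if (T₀ ∪ p.1)ᶜ ⊆ p.2 then (1 : ZMod 2) else 0)]
    refine sum_involution (fun p _ => p.swap) ?_ ?_ ?_ ?_
    · intro p hp
      have : (if (T₀ ∪ p.swap.1)ᶜ ⊆ p.swap.2 then (1 : ZMod 2) else 0) =
          (if (T₀ ∪ p.1)ᶜ ⊆ p.2 then (1 : ZMod 2) else 0) := by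
        simp only [Prod.fst_swap, Prod.snd_swap, hsymm p.2 p.1]
      rw [this]
      exact CharTwo.add_self_eq_zero _
    · intro p hp hne hfix
      apply hne
      have h12 : p.1 = p.2 := by
        have := congrArg Prod.fst hfix
        simpa using this.symm
      have hnot : ¬ (T₀ ∪ p.1)ᶜ ⊆ p.2 := by
        intro hsub
        apply hS' p.1 (mem_product.mp hp).1
        rw [← h12] at hsub
        ext x
        simp only [mem_union, mem_univ, iff_true]
        by_contra hx
        push Not at hx
        have hxc : x ∈ (T₀ ∪ p.1)ᶜ := by
          rw [mem_compl, mem_union]; push Not; exact hx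
        exact hx.2 (hsub hxc)
      rw [if_neg hnot]
    · intro p hp
      exact mem_product.mpr ⟨(mem_product.mp hp).2, (mem_product.mp hp).1⟩
    · intro p hp
      simp
  -- (e1) the faces `(T₀ ∪ S)ᶜ`, summed over `S ∈ 𝒮`
  have e1 : (#𝒮 : ZMod 2) + X = 0 := by
    have hS1 : ∀ S ∈ 𝒮, (1 + ∑ T ∈ E', ι S T) + ∑ S' ∈ 𝒮, (if (T₀ ∪ S)ᶜ ⊆ S' then (1 : ZMod 2) else 0) = 0 := by
      intro S hSm
      have h := hcon (T₀ ∪ S)ᶜ (hS S hSm)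
      have h1 : ∑ T ∈ 𝒯, (if Disjoint (T₀ ∪ S)ᶜ T then (1 : ZMod 2) else 0) = ∑ T ∈ 𝒯, ι S T := by
        refine sum_congr rfl fun T _ => ?_
        simp only [ι, disjoint_compl_left_iff]
      rw [h1, ← add_sum_erase 𝒯 (fun T => ι S T) hT₀] at h
      have h2 : ι S T₀ = 1 := by simp [ι]
      rw [h2] at h
      exact h
    have hsum := sum_eq_zero hS1
    rw [sum_add_distrib, sum_add_distrib, hhand, add_zero, sum_const, nsmul_eq_mul, mul_one] at hsum
    exact hsum
  -- symmetric relation on `E'`: `T ∩ T₁ ⊆ T₀`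
  have hsymm2 : ∀ T₁ T : Finset α, (Disjoint (T₁ \ T₀) T ↔ Disjoint (T \ T₀) T₁) := by
    intro T₁ T
    simp only [disjoint_left, mem_sdiff]
    constructor
    · rintro h x ⟨hxT, hxT₀⟩ hxT₁
      exact h ⟨hxT₁, hxT₀⟩ hxT
    · rintro h x ⟨hxT₁, hxT₀⟩ hxT
      exact h ⟨hxT, hxT₀⟩ hxT₁
  have hhand2 : ∑ T₁ ∈ E', ∑ T ∈ E', (if Disjoint (T₁ \ T₀) T then (1 : ZMod 2) else 0) = 0 := by
    rw [← sum_product (s := E') (t := E') (f := fun p => if Disjoint (p.1 \ T₀) p.2 then (1 : ZMod 2) else 0)]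
    refine sum_involution (fun p _ => p.swap) ?_ ?_ ?_ ?_
    · intro p hp
      have : (if Disjoint (p.swap.1 \ T₀) p.swap.2 then (1 : ZMod 2) else 0) =
          (if Disjoint (p.1 \ T₀) p.2 then (1 : ZMod 2) else 0) := by
        simp only [Prod.fst_swap, Prod.snd_swap, hsymm2 p.2 p.1]
      rw [this]
      exact CharTwo.add_self_eq_zero _
    · intro p hp hne hfix
      apply hne
      have h12 : p.1 = p.2 := by
        have := congrArg Prod.fst hfix
        simpa using this.symm
      have hp1 : p.1 ∈ E' := (mem_product.mp hp).1
      have hne1 : p.1 ≠ T₀ := (mem_erase.mp hp1).1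
      have hp1T : p.1 ∈ 𝒯 := (mem_erase.mp hp1).2
      have hnot : ¬ Disjoint (p.1 \ T₀) p.2 := by
        rw [← h12]
        intro hd
        have hsub : p.1 ⊆ T₀ := by
          intro x hx
          by_contra hxT₀
          exact disjoint_left.mp hd (mem_sdiff.mpr ⟨hx, hxT₀⟩) hx
        exact hne1 (hmin p.1 hp1T hsub)
      rw [if_neg hnot]
    · intro p hp
      exact mem_product.mpr ⟨(mem_product.mp hp).2, (mem_product.mp hp).1⟩
    · intro p hp
      simp
  -- (e2) the faces `T₁ \ T₀`, summed over `T₁ ∈ E'`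
  have e2 : (#E' : ZMod 2) + X = 0 := by
    have hT1 : ∀ T₁ ∈ E', (1 + ∑ T ∈ E', (if Disjoint (T₁ \ T₀) T then (1 : ZMod 2) else 0)) + ∑ S ∈ 𝒮, ι S T₁ = 0 := by
      intro T₁ hT₁
      have hne1 : T₁ ≠ T₀ := (mem_erase.mp hT₁).1
      have hT₁T : T₁ ∈ 𝒯 := (mem_erase.mp hT₁).2
      have h := hcon (T₁ \ T₀) (hdiff T₁ hT₁T hne1)
      have h2 : ∑ S ∈ 𝒮, (if T₁ \ T₀ ⊆ S then (1 : ZMod 2) else 0) = ∑ S ∈ 𝒮, ι S T₁ := by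
        refine sum_congr rfl fun S _ => ?_
        simp only [ι, sdiff_le_iff, sup_eq_union]
      rw [h2, ← add_sum_erase 𝒯 (fun T => if Disjoint (T₁ \ T₀) T then (1 : ZMod 2) else 0) hT₀] at h
      have h3 : (if Disjoint (T₁ \ T₀) T₀ then (1 : ZMod 2) else 0) = 1 := by simp [sdiff_disjoint]
      rw [h3] at h
      exact h
    have hsum := sum_eq_zero hT1
    rw [sum_add_distrib, sum_add_distrib, hhand2, add_zero, sum_const, nsmul_eq_mul, mul_one,
      sum_comm] at hsum
    exact hsum
  -- bookkeeping: `#𝒯 = #E' + 1`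
  have hc : (#𝒯 : ZMod 2) = #E' + 1 := by
    have := card_erase_add_one hT₀
    rw [← this]
    push_cast
    rfl
  have hTE : (#𝒯 : ZMod 2) + #E' = 0 := by linear_combination e0 - e1 + e2
  rw [hc] at hTE
  have h2E := CharTwo.add_self_eq_zero (#E' : ZMod 2)
  have hone : (1 : ZMod 2) = 0 := by linear_combination hTE - h2E
  exact one_ne_zero hone

/-- **Two-block parity Marica–Schönheim.**  Let `∅ ∈ Δ`; let all differences `T \ T₀` (`T ⊄ T₀`) inside the
"complemented" block `𝒞` lie in `Δ`; let `(T ∪ P)ᶜ ∈ Δ` and `T ∪ P ≠ univ` for `T ∈ 𝒞`, `P ∈ ℬ`; and let the "plain"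
block `ℬ` be GF(2)-independent on `Δ` (every nonempty `B ⊆ ℬ` is contained oddly often in some `U ∈ Δ`).  Then
`#𝒞 + #ℬ ≤ #Δ`.  Proof: the parity vectors of the pairs `(A, B)`, `A ⊆ 𝒞`, `B ⊆ ℬ`, are pairwise distinct subsets
of `Δ` — a coincidence gives, by `par_symmDiff`, an even configuration `(A ∆ A', B ∆ B')`, which the parity lemma
(if `A ∆ A' ≠ ∅`) or the independence of `ℬ` (if `B ∆ B' ≠ ∅`) forbids — so `2^{#𝒞} · 2^{#ℬ} ≤ 2^{#Δ}`. [this work] -/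
theorem card_add_card_le_card (Δ 𝒞 ℬ : Finset (Finset α)) (h0 : ∅ ∈ Δ)
    (h1 : ∀ T₀ ∈ 𝒞, ∀ T ∈ 𝒞, ¬ T ⊆ T₀ → T \ T₀ ∈ Δ)
    (h2 : ∀ T ∈ 𝒞, ∀ P ∈ ℬ, (T ∪ P)ᶜ ∈ Δ) (h2' : ∀ T ∈ 𝒞, ∀ P ∈ ℬ, T ∪ P ≠ univ)
    (h3 : ∀ B ⊆ ℬ, B.Nonempty → ∃ U ∈ Δ, (∑ S ∈ B, if U ⊆ S then (1 : ZMod 2) else 0) ≠ 0) :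
    #𝒞 + #ℬ ≤ #Δ := by
  classical
  -- the parity-vector map, valued in subsets of `Δ`
  let f : Finset (Finset α) × Finset (Finset α) → Finset (Finset α) := fun p =>
    Δ.filter (fun U => (∑ T ∈ p.1, if Disjoint U T then (1 : ZMod 2) else 0) +
      (∑ S ∈ p.2, if U ⊆ S then (1 : ZMod 2) else 0) ≠ 0)
  have hmaps : Set.MapsTo f ↑(𝒞.powerset ×ˢ ℬ.powerset) ↑(Δ.powerset) := by
    intro p _
    simp only [mem_coe, mem_powerset]
    exact filter_subset _ _
  have hinj : Set.InjOn f ↑(𝒞.powerset ×ˢ ℬ.powerset) := by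
    rintro ⟨A, B⟩ hAB ⟨A', B'⟩ hAB' hf
    simp only [coe_product, Set.mem_prod, mem_coe, mem_powerset] at hAB hAB'
    -- equal parity vectors on `Δ`, hence an even configuration for the symmetric differences
    have hzero : ∀ U ∈ Δ, (∑ T ∈ symmDiff A A', if Disjoint U T then (1 : ZMod 2) else 0) +
        (∑ S ∈ symmDiff B B', if U ⊆ S then (1 : ZMod 2) else 0) = 0 := by
      intro U hU
      have hiff : ((∑ T ∈ A, if Disjoint U T then (1 : ZMod 2) else 0) +
            (∑ S ∈ B, if U ⊆ S then (1 : ZMod 2) else 0) ≠ 0) ↔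
          ((∑ T ∈ A', if Disjoint U T then (1 : ZMod 2) else 0) +
            (∑ S ∈ B', if U ⊆ S then (1 : ZMod 2) else 0) ≠ 0) := by
        have := congrArg (fun s => U ∈ s) hf
        simp only [f, mem_filter, hU, true_and, eq_iff_iff] at this
        exact this
      rw [par_symmDiff, zmod2_eq_of_iff hiff, CharTwo.add_self_eq_zero]
    -- the `𝒞`-part of the difference is empty, by the parity lemma
    have hA : symmDiff A A' = ∅ := by
      by_contra hne
      obtain ⟨T₀, hT₀, hmin⟩ := (symmDiff A A').exists_minimal (nonempty_iff_ne_empty.mpr hne)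
      have hsub𝒞 : symmDiff A A' ⊆ 𝒞 := by
        intro T hT
        rcases mem_symmDiff.mp hT with ⟨h, _⟩ | ⟨h, _⟩
        · exact hAB.1 h
        · exact hAB'.1 h
      have hsubℬ : symmDiff B B' ⊆ ℬ := by
        intro S hS
        rcases mem_symmDiff.mp hS with ⟨h, _⟩ | ⟨h, _⟩
        · exact hAB.2 h
        · exact hAB'.2 h
      have hT₀𝒞 : T₀ ∈ 𝒞 := hsub𝒞 hT₀
      have hmin' : ∀ T ∈ symmDiff A A', T ⊆ T₀ → T = T₀ := by
        intro T hT hsub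
        exact Subset.antisymm hsub (hmin hT hsub)
      obtain ⟨U, hU, hneU⟩ := parity_lemma Δ (symmDiff A A') (symmDiff B B') T₀ h0 hT₀ hmin'
        (fun T hT hneq => h1 T₀ hT₀𝒞 T (hsub𝒞 hT) (fun hsub => hneq (hmin' T hT hsub)))
        (fun S hS => h2 T₀ hT₀𝒞 S (hsubℬ hS)) (fun S hS => h2' T₀ hT₀𝒞 S (hsubℬ hS))
      exact hneU (hzero U hU)
    have hAeq : A = A' := symmDiff_eq_bot.mp (by rw [Finset.bot_eq_empty]; exact hA)
    -- then the `ℬ`-part is an even family, hence empty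
    have hB : symmDiff B B' = ∅ := by
      by_contra hne
      have hsubℬ : symmDiff B B' ⊆ ℬ := by
        intro S hS
        rcases mem_symmDiff.mp hS with ⟨h, _⟩ | ⟨h, _⟩
        · exact hAB.2 h
        · exact hAB'.2 h
      obtain ⟨U, hU, hneU⟩ := h3 (symmDiff B B') hsubℬ (nonempty_iff_ne_empty.mpr hne)
      apply hneU
      have := hzero U hU
      rwa [hA, sum_empty, zero_add] at this
    have hBeq : B = B' := symmDiff_eq_bot.mp (by rw [Finset.bot_eq_empty]; exact hB)
    rw [hAeq, hBeq]
  have hcard := card_le_card_of_injOn f hmaps hinj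
  rw [card_product, card_powerset, card_powerset, card_powerset, ← pow_add] at hcard
  exact (Nat.pow_le_pow_iff_right (by norm_num)).mp hcard

/-- **A plain block with differences in `Δ` is GF(2)-independent.**  If `∅ ∈ Δ` and `P₀ \ P ∈ Δ` whenever
`P₀, P ∈ ℬ`, `P₀ ⊄ P`, then every nonempty `B ⊆ ℬ` is contained oddly often in some `U ∈ Δ` (Marica–Schönheim mod 2:
the parity lemma applied to the complements, the largest member of `B` giving the minimal complement). [this work] -/
theorem plain_oddly_seen (Δ ℬ : Finset (Finset α)) (h0 : ∅ ∈ Δ)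
    (hd : ∀ P₀ ∈ ℬ, ∀ P ∈ ℬ, ¬ P₀ ⊆ P → P₀ \ P ∈ Δ) :
    ∀ B ⊆ ℬ, B.Nonempty → ∃ U ∈ Δ, (∑ S ∈ B, if U ⊆ S then (1 : ZMod 2) else 0) ≠ 0 := by
  classical
  intro B hB hne
  obtain ⟨P₀, hP₀, hmax⟩ := B.exists_maximal hne
  have hmin : ∀ T ∈ B.image compl, T ⊆ P₀ᶜ → T = P₀ᶜ := by
    intro T hT hsub
    obtain ⟨P, hP, rfl⟩ := mem_image.mp hT
    have hP₀P : P₀ ⊆ P := compl_subset_compl.mp hsub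
    have : P = P₀ := Subset.antisymm (hmax hP hP₀P) hP₀P
    rw [this]
  have hdiff : ∀ T ∈ B.image compl, T ≠ P₀ᶜ → T \ P₀ᶜ ∈ Δ := by
    intro T hT hneq
    obtain ⟨P, hP, rfl⟩ := mem_image.mp hT
    have hneq' : P ≠ P₀ := fun h => hneq (by rw [h])
    have hnot : ¬ P₀ ⊆ P := fun hsub => hneq' (Subset.antisymm (hmax hP hsub) hsub)
    have hset : Pᶜ \ P₀ᶜ = P₀ \ P := by
      ext x
      simp only [mem_sdiff, mem_compl, not_not]
      tauto
    rw [hset]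
    exact hd P₀ (hB hP₀) P (hB hP) hnot
  obtain ⟨U, hU, hneU⟩ := parity_lemma Δ (B.image compl) ∅ P₀ᶜ h0 (mem_image_of_mem _ hP₀) hmin hdiff
    (by simp) (by simp)
  refine ⟨U, hU, ?_⟩
  rw [sum_empty, add_zero, sum_image (fun P _ P' _ h => compl_injective h)] at hneU
  have hcongr : ∑ P ∈ B, (if Disjoint U Pᶜ then (1 : ZMod 2) else 0) =
      ∑ S ∈ B, (if U ⊆ S then (1 : ZMod 2) else 0) := by
    refine sum_congr rfl fun P _ => ?_
    have hiff : Disjoint U Pᶜ ↔ U ⊆ P := disjoint_compl_right_iff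
    by_cases hUP : U ⊆ P
    · rw [if_pos hUP, if_pos (hiff.mpr hUP)]
    · rw [if_neg hUP, if_neg (fun h => hUP (hiff.mp h))]
  rwa [hcongr] at hneU

/-- **Two-family Marica–Schönheim modulo 2.**  If `∅ ∈ Δ`, the differences `T \ T₀` (`T ⊄ T₀`) inside `𝒞` and
`P₀ \ P` (`P₀ ⊄ P`) inside `ℬ` lie in `Δ`, and `(T ∪ P)ᶜ ∈ Δ`, `T ∪ P ≠ univ` across the two families, then
`#𝒞 + #ℬ ≤ #Δ`.  (Compare `OrderedDifferences.card_add_card_le_card_diffs_union`, where the cross terms are the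
differences `C \ B`: here `𝒞` is read through complements, so the cross term `(T ∪ P)ᶜ = Tᶜ \ P`.) [this work] -/
theorem card_add_card_le_card_of_diffs (Δ 𝒞 ℬ : Finset (Finset α)) (h0 : ∅ ∈ Δ)
    (h1 : ∀ T₀ ∈ 𝒞, ∀ T ∈ 𝒞, ¬ T ⊆ T₀ → T \ T₀ ∈ Δ)
    (hP : ∀ P₀ ∈ ℬ, ∀ P ∈ ℬ, ¬ P₀ ⊆ P → P₀ \ P ∈ Δ)
    (h2 : ∀ T ∈ 𝒞, ∀ P ∈ ℬ, (T ∪ P)ᶜ ∈ Δ) (h2' : ∀ T ∈ 𝒞, ∀ P ∈ ℬ, T ∪ P ≠ univ) :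
    #𝒞 + #ℬ ≤ #Δ :=
  card_add_card_le_card Δ 𝒞 ℬ h0 h1 h2 h2' (plain_oddly_seen Δ ℬ h0 hP)

/-- **Marica–Schönheim modulo 2 (one block).**  If `∅ ∈ Δ` and `T \ T₀ ∈ Δ` whenever `T₀, T ∈ 𝒞`, `T ⊄ T₀`, then
`#𝒞 ≤ #Δ`. [this work] -/
theorem card_le_card_of_diffs (Δ 𝒞 : Finset (Finset α)) (h0 : ∅ ∈ Δ)
    (h1 : ∀ T₀ ∈ 𝒞, ∀ T ∈ 𝒞, ¬ T ⊆ T₀ → T \ T₀ ∈ Δ) : #𝒞 ≤ #Δ := by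
  have h := card_add_card_le_card_of_diffs Δ 𝒞 ∅ h0 h1 (by simp) (by simp) (by simp)
  simpa using h

end ParityMS

end Summit.CriticalPhenomena.PercolationContinuityZ3.Theorems
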